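import Mathlib
import HarnessLib
import Summits.Ventures.LatticeQCDFlow.Scaling.AcceptanceGiniFloor
import Summits.Ventures.LatticeQCDFlow.Scoring.AcceptanceMonitorBatch

/-!
# LatticeQCDFlow / Scaling — the SHARP ESS floor of the acceptance: `(1 − acc)² ≤ (1/ESS − 1)/3`,
# via "the Gini mean difference is at most `2/√3` standard deviations" on a finite space

HONEST FRAMING: exact (Metropolis-corrected) sampling algorithms for lattice gauge theory;
figures of merit are autocorrelation/cost numbers at stated couplings and volumes; no
continuum-physics claim.

Venture `LatticeQCDFlow` (cell pub-lqcd), topic `Scaling`; FANOUT row 3 (`s0-u1-a`, S0-B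
implementation A, GEN-6).  NEW WORK of the cell (a sorting-free finite proof by cyclic
symmetrisation over three independent copies), not a published result; NO definition is
introduced.  Sequel of row 3's `Scaling/AcceptanceGiniFloor` (`1 − acc = ½·E_{q⊗q}|w − w′|`;
Cauchy–Schwarz constant: `(1 − acc)² ≤ (1/ESS − 1)/2`, flagged there as not sharp) and of
`Scoring/AcceptanceMonitorBatch` (the batch instantiation).  Printed counterpart NAMED ONLY
(nothing is cited as a tree fact): the Gini index as a covariance with the distribution function,
`G = 2·cov(W, F(W))/E W` (Arnold, *Pareto Distributions* (2015) §4.2 eq. (4.2.10), crediting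
Ord–Patil–Taillie 1978) [corpus: book:arnold2015-pareto-distributions p.141], from which
`E|W − W′| ≤ (2/√3)·σ_W` follows for continuous `F` by Cauchy–Schwarz (`Var F(W) = 1/12`); the
finite-space statement below needs the mid-rank in place of `F` and a separate argument for its
second moment.

## Content (finite state space)

* `real_sign_sub_swap` — sign bookkeeping (`|r| = sign r · r` is re-derived inline; the tree has it
  as `Literature.Analysis.FunctionSpaces.BMOInv.real_sign_mul_self_eq_abs`);
* **`three_sign_cyclic_le_one`** — for reals `a, b, c`:
  `sign(a−b)sign(a−c) + sign(b−c)sign(b−a) + sign(c−a)sign(c−b) ≤ 1` (of three values at most two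
  are extreme: the cyclic sum is `1` unless all three coincide, then `0`);
* `qq_abs_sub_eq_two_sum_midrank` — for ANY law `q` and values `w`:
  `Σ_xΣ_y q_x q_y|w_x − w_y| = 2·Σ_x q_x w_x g_x` with the mid-rank `g_x = Σ_y q_y sign(w_x − w_y)`
  (`= q(W < w_x) − q(W > w_x)`); `sum_midrank_eq_zero` — `Σ_x q_x g_x = 0`;
* **`sum_midrank_sq_le_third`** — `Σ_x q_x g_x² ≤ 1/3` for every probability vector `q ≥ 0`:
  expand the square into a triple sum over three independent copies, add the three cyclic
  relabelings (each equal to the original) and bound the integrand by `three_sign_cyclic_le_one`;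
* **`sq_qq_abs_weight_le_sharp`** — `(E_{q⊗q}|w − w′|)² ≤ (4/3)(1/ESS − 1)` for the importance
  weights of a normalised target against a positive normalised model (centre `w` at its mean `1`,
  Cauchy–Schwarz against the mid-rank, second moment `≤ 1/3`);
* **`sq_one_sub_accRate_le_third`**, **`one_sub_sqrt_third_le_accRate`** —
  `(1 − acc)² ≤ (1/ESS − 1)/3`, i.e. `acc ≥ 1 − √((1/ESS − 1)/3)`: population `ESS/N = 0.8` forces
  `acc ≥ 0.711` (`/2`-floor `0.646`, `Scaling/Acceptance` floor `0.5`), `0.99` forces `≥ 0.942`;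
  vacuous only below `ESS = 1/4`; `max_essFrac_half_one_sub_sqrt_third_le_accRate` joins it with
  `acc ≥ ESS/2`;
* on the batch (`Scoring` namespace): `sq_one_sub_plugIn_le_third` and
  **`one_sub_accMonitor_le_sharp`** — on every positive batch of `n ≥ 2` proposals the trainer's
  two monitors satisfy `1 − acc_est ≤ (n/(n−1))·√((1/ess − 1)/3)` identically.

Why `1/3` is the right constant (remark, not typed): for `m` equally likely, equally spaced weights
the ratio `(E|W − W′|)²/Var W` increases to `4/3` as `m → ∞` (the uniform law: `E|U − U′| = 1/3`,
`Var U = 1/12`), so no constant below `1/3` can replace it in `sq_one_sub_accRate_le_third` for all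
finite laws.  NOT CLAIMED: that bound's attainment on a fixed finite space; anything out of
equilibrium; any number for a trained network; nothing re-scored, no number of record moves.

Elementary (`[folklore]`-level); farm `lean check` rc 0, no `sorry`.
-/

namespace Summit.Ventures.LatticeQCDFlow.Theory2

open Finset
open Literature.Probability.MarkovChains
open Summit.Ventures.LatticeQCDFlow.Exactness

variable {X : Type*} [Fintype X]

/-! ### Sign bookkeeping -/

/-- Antisymmetry: `sign (b − a) = − sign (a − b)`. [folklore] -/
theorem real_sign_sub_swap (a b : ℝ) : Real.sign (b - a) = -Real.sign (a - b) := by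
  rw [← Real.sign_neg, neg_sub]

/-- **The three-point sign inequality.**  For any reals `a, b, c`:
`sign(a−b)·sign(a−c) + sign(b−c)·sign(b−a) + sign(c−a)·sign(c−b) ≤ 1` — among three values at most
"two of them are extreme"; the cyclic sum is `1` when the values are pairwise distinct or exactly two
coincide, and `0` when all three coincide. [folklore] -/
theorem three_sign_cyclic_le_one (a b c : ℝ) :
    Real.sign (a - b) * Real.sign (a - c) + Real.sign (b - c) * Real.sign (b - a)
      + Real.sign (c - a) * Real.sign (c - b) ≤ 1 := by
  rcases lt_trichotomy a b with h1 | h1 | h1 <;>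
  rcases lt_trichotomy a c with h2 | h2 | h2 <;>
  rcases lt_trichotomy b c with h3 | h3 | h3 <;>
  simp only [h1, h2, h3, Real.sign_of_pos, Real.sign_of_neg, sub_pos, sub_neg, sub_self,
    Real.sign_zero] <;>
  norm_num

/-! ### The Gini mean difference through the mid-rank function -/

/-- **Gini mean difference = twice the covariance with the mid-rank**: for any law `q` and values
`w`, `Σ_xΣ_y q_x q_y |w_x − w_y| = 2 Σ_x q_x w_x g_x` with the mid-rank (centred rank) function
`g_x = Σ_y q_y sign(w_x − w_y) = q(W < w_x) − q(W > w_x)`. [folklore] -/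
theorem qq_abs_sub_eq_two_sum_midrank (q w : X → ℝ) :
    ∑ x, ∑ y, q x * q y * |w x - w y|
      = 2 * ∑ x, q x * w x * ∑ y, q y * Real.sign (w x - w y) := by
  -- `|r| = sign r · r` (also in the tree as `Literature…BMOInv.real_sign_mul_self_eq_abs`;
  -- re-derived inline to keep this file's imports inside the venture)
  have habs : ∀ r : ℝ, Real.sign r * r = |r| := by
    intro r
    rcases lt_trichotomy r 0 with h | h | h
    · rw [Real.sign_of_neg h, abs_of_neg h]; ring
    · rw [h, Real.sign_zero, abs_zero, mul_zero]
    · rw [Real.sign_of_pos h, abs_of_pos h, one_mul]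
  have h1 : ∀ x y, q x * q y * |w x - w y|
      = q x * w x * (q y * Real.sign (w x - w y)) - q y * w y * (q x * Real.sign (w x - w y)) := by
    intro x y; rw [← habs]; ring
  have hA : ∑ x, ∑ y, q x * w x * (q y * Real.sign (w x - w y))
      = ∑ x, q x * w x * ∑ y, q y * Real.sign (w x - w y) := by
    refine sum_congr rfl fun x _ => ?_
    rw [mul_sum]
  have hB : ∑ x, ∑ y, q y * w y * (q x * Real.sign (w x - w y))
      = -∑ y, q y * w y * ∑ x, q x * Real.sign (w y - w x) := by
    rw [Finset.sum_comm, ← sum_neg_distrib]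
    refine sum_congr rfl fun y _ => ?_
    rw [mul_sum, ← sum_neg_distrib]
    refine sum_congr rfl fun x _ => ?_
    rw [real_sign_sub_swap (w y) (w x)]
    ring
  simp_rw [h1, sum_sub_distrib]
  rw [hA, hB]
  ring

/-- **The mid-rank is centred**: `Σ_x q_x g_x = 0` (antisymmetry of the sign). [folklore] -/
theorem sum_midrank_eq_zero (q w : X → ℝ) :
    ∑ x, q x * ∑ y, q y * Real.sign (w x - w y) = 0 := by
  have hT : ∑ x, ∑ y, q x * (q y * Real.sign (w x - w y))
      = -(∑ x, ∑ y, q x * (q y * Real.sign (w x - w y))) := by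
    conv_rhs => rw [Finset.sum_comm]
    rw [← sum_neg_distrib]
    refine sum_congr rfl fun x _ => ?_
    rw [← sum_neg_distrib]
    refine sum_congr rfl fun y _ => ?_
    rw [real_sign_sub_swap (w x) (w y)]
    ring
  have h0 : ∑ x, ∑ y, q x * (q y * Real.sign (w x - w y)) = 0 := by linarith
  simpa only [mul_sum] using h0

/-- **The mid-rank has second moment at most `1/3`** under any probability vector `q ≥ 0`:
`Σ_x q_x g_x² ≤ 1/3` (equality for pairwise-distinct, "continuous-like" values in the limit; the
uniform law on `[0,1]` has `E(2F − 1)² = 1/3`).  Proof: expand the square into a triple sum, add its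
three cyclic relabelings and use `three_sign_cyclic_le_one` pointwise. -/
theorem sum_midrank_sq_le_third {q : X → ℝ} (w : X → ℝ) (hq : ∀ x, 0 ≤ q x)
    (hq1 : ∑ x, q x = 1) :
    ∑ x, q x * (∑ y, q y * Real.sign (w x - w y)) ^ 2 ≤ 1 / 3 := by
  -- the triple-sum form
  have hL : ∑ x, q x * (∑ y, q y * Real.sign (w x - w y)) ^ 2
      = ∑ x, ∑ y, ∑ z, q x * q y * q z * (Real.sign (w x - w y) * Real.sign (w x - w z)) := by
    refine sum_congr rfl fun x _ => ?_
    rw [sq, sum_mul_sum, mul_sum]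
    refine sum_congr rfl fun y _ => ?_
    rw [mul_sum]
    exact sum_congr rfl fun z _ => by ring
  -- the two cyclic relabelings have the same value
  have hI2 : ∑ x, ∑ y, ∑ z, q x * q y * q z * (Real.sign (w y - w z) * Real.sign (w y - w x))
      = ∑ x, ∑ y, ∑ z, q x * q y * q z * (Real.sign (w x - w y) * Real.sign (w x - w z)) := by
    rw [Finset.sum_comm]
    exact sum_congr rfl fun a _ => sum_congr rfl fun b _ => sum_congr rfl fun c _ => by ring
  have hI3 : ∑ x, ∑ y, ∑ z, q x * q y * q z * (Real.sign (w z - w x) * Real.sign (w z - w y))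
      = ∑ x, ∑ y, ∑ z, q x * q y * q z * (Real.sign (w x - w y) * Real.sign (w x - w z)) := by
    rw [sum_congr rfl fun x _ => Finset.sum_comm, Finset.sum_comm]
    exact sum_congr rfl fun a _ => sum_congr rfl fun b _ => sum_congr rfl fun c _ => by ring
  -- symmetrise
  have hsym : 3 * ∑ x, ∑ y, ∑ z, q x * q y * q z * (Real.sign (w x - w y) * Real.sign (w x - w z))
      = ∑ x, ∑ y, ∑ z, q x * q y * q z *
          (Real.sign (w x - w y) * Real.sign (w x - w z)
            + Real.sign (w y - w z) * Real.sign (w y - w x)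
            + Real.sign (w z - w x) * Real.sign (w z - w y)) := by
    simp_rw [mul_add, sum_add_distrib]
    rw [hI2, hI3]
    ring
  -- pointwise bound and total mass one
  have hbound : ∑ x, ∑ y, ∑ z, q x * q y * q z *
          (Real.sign (w x - w y) * Real.sign (w x - w z)
            + Real.sign (w y - w z) * Real.sign (w y - w x)
            + Real.sign (w z - w x) * Real.sign (w z - w y))
      ≤ ∑ x, ∑ y, ∑ z, q x * q y * q z :=
    sum_le_sum fun x _ => sum_le_sum fun y _ => sum_le_sum fun z _ =>
      mul_le_of_le_one_right (mul_nonneg (mul_nonneg (hq x) (hq y)) (hq z))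
        (three_sign_cyclic_le_one (w x) (w y) (w z))
  have hone : ∑ x, ∑ y, ∑ z, q x * q y * q z = 1 := by
    have h2 : ∀ x y, ∑ z, q x * q y * q z = q x * q y := fun x y => by
      rw [← mul_sum, hq1, mul_one]
    simp_rw [h2]
    have h3 : ∀ x, ∑ y, q x * q y = q x := fun x => by rw [← mul_sum, hq1, mul_one]
    simp_rw [h3]
    exact hq1
  rw [hL]
  linarith

/-! ### The sharp ESS floor -/

/-- **`(E_{q⊗q}|w − w′|)² ≤ (4/3)·(1/ESS − 1)`** — the Gini mean difference of the weights is at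
most `2/√3` standard deviations (the classical sharp constant; uniform weights attain it in the
limit), improving the Cauchy–Schwarz constant `2` of `sq_qq_abs_weight_le` (`≤ 2(1/ESS − 1)`). -/
theorem sq_qq_abs_weight_le_sharp {p q : X → ℝ} (hq : ∀ x, 0 < q x) (hp1 : ∑ x, p x = 1)
    (hq1 : ∑ x, q x = 1) :
    (∑ x, ∑ y, q x * q y * |weight p q x - weight p q y|) ^ 2
      ≤ 4 / 3 * ((essFrac p q)⁻¹ - 1) := by
  set g : X → ℝ := fun x => ∑ y, q y * Real.sign (weight p q x - weight p q y) with hg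
  have hS1 : ∑ x, q x * weight p q x = 1 := sum_mul_weight hq hp1
  have hS2 : ∑ x, q x * weight p q x ^ 2 = (essFrac p q)⁻¹ :=
    sum_mul_weight_sq_eq_inv_essFrac hq hp1
  have hΔ : ∑ x, ∑ y, q x * q y * |weight p q x - weight p q y|
      = 2 * ∑ x, q x * weight p q x * g x :=
    qq_abs_sub_eq_two_sum_midrank q (weight p q)
  have hg0 : ∑ x, q x * g x = 0 := sum_midrank_eq_zero q (weight p q)
  -- centre the weight: `Σ q w g = Σ q (w − 1) g`
  have hcentre : ∑ x, q x * weight p q x * g x = ∑ x, q x * (weight p q x - 1) * g x := by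
    have h : ∑ x, q x * (weight p q x - 1) * g x
        = ∑ x, q x * weight p q x * g x - ∑ x, q x * g x := by
      rw [← sum_sub_distrib]
      exact sum_congr rfl fun x _ => by ring
    rw [h, hg0, sub_zero]
  -- the variance of the weights
  have hvar : ∑ x, q x * (weight p q x - 1) ^ 2 = (essFrac p q)⁻¹ - 1 := by
    have h : ∀ x, q x * (weight p q x - 1) ^ 2
        = q x * weight p q x ^ 2 - 2 * (q x * weight p q x) + q x := fun x => by ring
    simp_rw [h]
    rw [sum_add_distrib, sum_sub_distrib, ← mul_sum, hS2, hS1, hq1]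
    ring
  -- Cauchy–Schwarz with weights `q`
  have hCS : (∑ x, q x * (weight p q x - 1) * g x) ^ 2
      ≤ (∑ x, q x * (weight p q x - 1) ^ 2) * ∑ x, q x * g x ^ 2 := by
    have h := Finset.sum_mul_sq_le_sq_mul_sq (Finset.univ : Finset X)
      (fun x => Real.sqrt (q x) * (weight p q x - 1)) (fun x => Real.sqrt (q x) * g x)
    have e1 : ∀ x, Real.sqrt (q x) * (weight p q x - 1) * (Real.sqrt (q x) * g x)
        = q x * (weight p q x - 1) * g x := fun x => by
      have hs : Real.sqrt (q x) * Real.sqrt (q x) = q x := Real.mul_self_sqrt (hq x).le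
      calc Real.sqrt (q x) * (weight p q x - 1) * (Real.sqrt (q x) * g x)
          = Real.sqrt (q x) * Real.sqrt (q x) * (weight p q x - 1) * g x := by ring
        _ = q x * (weight p q x - 1) * g x := by rw [hs]
    have e2 : ∀ x, (Real.sqrt (q x) * (weight p q x - 1)) ^ 2 = q x * (weight p q x - 1) ^ 2 :=
      fun x => by rw [mul_pow, Real.sq_sqrt (hq x).le]
    have e3 : ∀ x, (Real.sqrt (q x) * g x) ^ 2 = q x * g x ^ 2 :=
      fun x => by rw [mul_pow, Real.sq_sqrt (hq x).le]
    simp_rw [e1, e2, e3] at h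
    exact h
  have hthird : ∑ x, q x * g x ^ 2 ≤ 1 / 3 :=
    sum_midrank_sq_le_third (weight p q) (fun x => (hq x).le) hq1
  have hvar0 : 0 ≤ (essFrac p q)⁻¹ - 1 := by
    rw [← hvar]; exact sum_nonneg fun x _ => mul_nonneg (hq x).le (sq_nonneg _)
  rw [hΔ, hcentre]
  rw [hvar] at hCS
  nlinarith [hCS, hthird, hvar0, sq_nonneg (∑ x, q x * (weight p q x - 1) * g x)]

/-- **`(1 − acc)² ≤ (1/ESS − 1)/3`** (sharp constant). -/
theorem sq_one_sub_accRate_le_third {p q : X → ℝ} (hq : ∀ x, 0 < q x) (hp1 : ∑ x, p x = 1)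
    (hq1 : ∑ x, q x = 1) : (1 - accRate p q) ^ 2 ≤ ((essFrac p q)⁻¹ - 1) / 3 := by
  rw [one_sub_accRate_eq_half_qq_abs_weight hq hp1 hq1, div_pow]
  have h := sq_qq_abs_weight_le_sharp hq hp1 hq1
  linarith

/-- **ESS floors acceptance with the sharp constant: `acc ≥ 1 − √((1/ESS − 1)/3)`.**  Population
`ESS/N = 0.8` forces `acc ≥ 0.711` (`…/2`: `0.646`; `Scaling/Acceptance`: `0.5`), `0.99` forces
`acc ≥ 0.942`; vacuous only below `ESS = 1/4`. -/
theorem one_sub_sqrt_third_le_accRate {p q : X → ℝ} (hq : ∀ x, 0 < q x) (hp1 : ∑ x, p x = 1)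
    (hq1 : ∑ x, q x = 1) :
    1 - Real.sqrt (((essFrac p q)⁻¹ - 1) / 3) ≤ accRate p q := by
  have h1 : 1 - accRate p q ≤ Real.sqrt ((1 - accRate p q) ^ 2) := by
    rw [Real.sqrt_sq_eq_abs]; exact le_abs_self _
  have h2 : Real.sqrt ((1 - accRate p q) ^ 2) ≤ Real.sqrt (((essFrac p q)⁻¹ - 1) / 3) :=
    Real.sqrt_le_sqrt (sq_one_sub_accRate_le_third hq hp1 hq1)
  linarith

/-- **All three floors at once**: `max(ESS/2, 1 − √((1/ESS − 1)/3)) ≤ acc` (the `/3` floor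
dominates the `/2` floor everywhere). -/
theorem max_essFrac_half_one_sub_sqrt_third_le_accRate {p q : X → ℝ} (hp : ∀ x, 0 < p x)
    (hq : ∀ x, 0 < q x) (hp1 : ∑ x, p x = 1) (hq1 : ∑ x, q x = 1) :
    max (essFrac p q / 2) (1 - Real.sqrt (((essFrac p q)⁻¹ - 1) / 3)) ≤ accRate p q :=
  max_le (essFrac_half_le_accRate hp hq hp1) (one_sub_sqrt_third_le_accRate hq hp1 hq1)

end Summit.Ventures.LatticeQCDFlow.Theory2

/-! ### On the batch -/

namespace Summit.Ventures.LatticeQCDFlow.Scoring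

open Finset
open Summit.Ventures.LatticeQCDFlow.Exactness
open Summit.Ventures.LatticeQCDFlow.Theory2

variable {ι : Type*} [Fintype ι]

/-- **`(1 − plug-in)² ≤ (1/Kish-fraction − 1)/3`** on every positive batch. -/
theorem sq_one_sub_plugIn_le_third [Nonempty ι] {W : ι → ℝ} (hW : ∀ i, 0 < W i) :
    (1 - (∑ i, ∑ j, min (W i) (W j)) / (Fintype.card ι * ∑ i, W i)) ^ 2
      ≤ ((Fintype.card ι * ∑ i, W i ^ 2) / (∑ i, W i) ^ 2 - 1) / 3 := by
  have hS : 0 < ∑ j, W j := sum_pos (fun i _ => hW i) univ_nonempty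
  have hn : 0 < (Fintype.card ι : ℝ) := Nat.cast_pos.2 Fintype.card_pos
  have h := sq_one_sub_accRate_le_third (p := fun i => W i / ∑ j, W j)
    (q := fun _ => ((Fintype.card ι : ℝ))⁻¹) (fun _ => inv_pos.2 hn) (sum_selfNorm_eq_one hW)
    sum_uniform_eq_one
  rwa [accRate_selfNorm_uniform hW, essFrac_selfNorm_uniform hW, inv_div] at h

/-- **Sharp monitor floor**: on every positive batch of `n ≥ 2` proposals,
`1 − acc_est ≤ (n/(n−1)) · √((1/ess − 1)/3)` with `1/ess = n ΣW²/(ΣW)²`. -/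
theorem one_sub_accMonitor_le_sharp [DecidableEq ι] {W : ι → ℝ} (hW : ∀ i, 0 < W i)
    (hn : 2 ≤ Fintype.card ι) :
    1 - (∑ i, ∑ j ∈ univ.erase i, min (W i) (W j)) / ((Fintype.card ι - 1) * ∑ i, W i)
      ≤ Fintype.card ι / (Fintype.card ι - 1)
        * Real.sqrt (((Fintype.card ι * ∑ i, W i ^ 2) / (∑ i, W i) ^ 2 - 1) / 3) := by
  haveI : Nonempty ι := Fintype.card_pos_iff.1 (by omega)
  have hnpos : 0 < (Fintype.card ι : ℝ) := Nat.cast_pos.2 Fintype.card_pos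
  have hn1 : 0 < (Fintype.card ι : ℝ) - 1 := by
    have : (2 : ℝ) ≤ Fintype.card ι := by exact_mod_cast hn
    linarith
  have hV : 1 - (∑ i, ∑ j, min (W i) (W j)) / (Fintype.card ι * ∑ i, W i)
      ≤ Real.sqrt (((Fintype.card ι * ∑ i, W i ^ 2) / (∑ i, W i) ^ 2 - 1) / 3) := by
    have h1 : 1 - (∑ i, ∑ j, min (W i) (W j)) / (Fintype.card ι * ∑ i, W i)
        ≤ Real.sqrt ((1 - (∑ i, ∑ j, min (W i) (W j)) / (Fintype.card ι * ∑ i, W i)) ^ 2) := by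
      rw [Real.sqrt_sq_eq_abs]; exact le_abs_self _
    exact h1.trans (Real.sqrt_le_sqrt (sq_one_sub_plugIn_le_third hW))
  rw [accMonitor_eq_plugIn hW hn]
  have e : 1 - (Fintype.card ι * ((∑ i, ∑ j, min (W i) (W j)) / (Fintype.card ι * ∑ i, W i)) - 1)
        / (Fintype.card ι - 1)
      = Fintype.card ι / (Fintype.card ι - 1)
        * (1 - (∑ i, ∑ j, min (W i) (W j)) / (Fintype.card ι * ∑ i, W i)) := by
    field_simp
    ring
  rw [e]
  exact mul_le_mul_of_nonneg_left hV (div_pos hnpos hn1).le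

end Summit.Ventures.LatticeQCDFlow.Scoring
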